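import Mathlib
import HarnessLib

/-!
# Route `ByReductionTypeAtTwo` (rung K4), crux `AdditiveRankZeroAtTwo` (item
# stmt-BirchSwinnertonDyer-19098): the ALGEBRAIC CORES of the two ROAD-CLOSED theorems of
# VERDICT-19098-addL2x-GEN4 (cell `bsd-2adic`, seat `bsd-2adic-addL2x` GEN 4)

HONEST FRAMING (run/shared/lean/pub/bsd-2adic/, HUMAN RULINGS D-0036/D-0074): theorems only, all by
`decide`/elementary group theory; NO new definition of an arithmetic object, NO named fact, nothing
asserted about any curve; no class closed; nothing booked (D-0054); BSD is not proved by any of this.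
PARTITION: X5@2 ADDITIVE, defect-`≥ 3` sub-class (1 382 classes) × p = 2 — typed obstruction
(structural); closes none. bears_on: K4 (item 19098).

WHAT THIS FILE PINS (the number theory lives in the memo; here only the finite algebra is checked).

(T1, algebraic core) `S₃` acting on `ℤ³` by permuting coordinates: the augmentation kernel
`P = ⟨e₀ − e₁, e₁ − e₂⟩` affords the `2`-dimensional representation `r ↦ R = [[0,−1],[1,−1]]`,
`s ↦ S = [[−1,1],[0,1]]`, and `X = 1 + 2R = [[1,−2],[2,−1]]` satisfies `XR = RX`, `XS = −SX`
(so `X·ρ(g) = sgn(g)·ρ(g)·X` on `S₃ = ⟨r, s⟩`), `det X = 3`, `X·adj(X) = 3`, and every intertwiner is a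
multiple of `X`. READING (memo §1): over any ring in which `3` is a unit — `ℤ₂`, `ℤ_p`
(`p ≥ 5`), `ℚ` — `P ≅ sgn ⊗ P`; for a non-Galois cubic field `F` with Galois closure `L`,
quadratic resolvent `K = ℚ(√D)`, and ANY `E/ℚ`, the Weil restriction `A = Res_{F/ℚ} E_F` is isogenous
to `E × B` by a `3`-power isogeny (Hecke relation `J² = J + 2`, `(1 + J)(J − 2) = 0`,
`(1 + J) − (J − 2) = 3` below) and `X` is the matrix of the degree-`9` isogeny
`r − r² : B → B^{(D)}` defined over `ℚ`; hence for every prime `p ≠ 3`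
`Sel_{p^∞}(E/F) ≅ Sel_{p^∞}(E/ℚ) ⊕ Sel_{p^∞}(B/ℚ)` and `Sel_{p^∞}(E^{(D)}/F) ≅ Sel_{p^∞}(E^{(D)}/ℚ) ⊕
Sel_{p^∞}(B/ℚ)` with the SAME second summand — the `E/ℚ`-summand keeps its local condition at the
ADDITIVE prime `2` unchanged: base change to the cubic field of good reduction does not alter the
`2`-primary Selmer problem of `E/ℚ`, it adds the abelian surface `B`.

(T2, core) For a group `G`, an element `t`, and integer coefficients `n_H` on a finite set of
subgroups containing `⊤`: if every `H ≠ ⊤` with `n_H ≠ 0` contains NO conjugate of `t`, then the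
permutation-character sum `Σ n_H · #Fix_t(G/H)` equals `n_⊤`; so a relation `Σ n_H · #Fix_t(G/H) = 0`
(any Brauer relation evaluated at `t`) with `n_⊤ ≠ 0` must contain a subgroup meeting the conjugacy
class of `t`. READING (memo §2): with `t` an inertia element at `2` acting non-scalarly on `V_ℓ(E)`
(exists iff defect `≥ 3`), «`H` meets the class of `t̄`» ⟹ «`E` (and every twist of `E_{M^H}` by a
character) is ADDITIVE at some prime above `2` of `M^H`» — no Artin-formalism / Weil-restriction identity of BSD quotients (Dokchitser–Dokchitser 2010
Thm 2.3, Milne 1972) expresses `δ_p(E/ℚ)` through curves with good reduction above `2` alone; an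
additive-at-`2` ANCHOR is unavoidable, and GEN 3's twist cancellation `𝟙 − χ_D` is the optimal shape.

References: [DokchitserDokchitserAnnals2010] §2.3–2.4 (Brauer relations, `S₃` example);
[Milne1972ArithmeticAV] §1 Thm. 1 (Weil restriction); [MilneADT2006] Thm. I.7.3 (isogeny invariance). Memo: run/shared/lean/pub/bsd-2adic/addL2x/
VERDICT-19098-addL2x-GEN4.md.
-/

set_option autoImplicit false
-- the Theorems namespace of this sub repeats the summit name by design (D-0017 nested layout)
set_option linter.dupNamespace false

namespace Summit.BirchSwinnertonDyer.BirchSwinnertonDyer.Theorems.CubicResolvent.RoadClosed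

/-! ## (T1) The `2`-dimensional representation of `S₃` and the intertwiner `1 + 2·R`

All statements are identities between explicit integer matrices (no definitions): `R = [[0,−1],[1,−1]]`
and `S = [[−1,1],[0,1]]` are the matrices of the `3`-cycle `r : e₀ ↦ e₁ ↦ e₂ ↦ e₀` and of the
transposition `s = (e₀ e₁)` on the augmentation kernel `P = ⟨e₀ − e₁, e₁ − e₂⟩ ⊂ ℤ³` (columns = images
of the basis vectors); `X = [[1,−2],[2,−1]] = 1 + 2R = R − R²`. -/

section S3Lattice

/-- The matrices `R` (3-cycle) and `S` (transposition) satisfy the presentation of `S₃`: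
`R³ = 1`, `S² = 1`, `(S R)² = 1` — so `r ↦ R`, `s ↦ S` is the representation of `S₃` on the
augmentation kernel `P ⊂ ℤ³`. [folklore] -/
theorem S3_presentation :
    (!![0, -1; 1, -1] : Matrix (Fin 2) (Fin 2) ℤ) ^ 3 = 1 ∧
    (!![-1, 1; 0, 1] : Matrix (Fin 2) (Fin 2) ℤ) ^ 2 = 1 ∧
    ((!![-1, 1; 0, 1] : Matrix (Fin 2) (Fin 2) ℤ) * !![0, -1; 1, -1]) ^ 2 = 1 := by
  refine ⟨?_, ?_, ?_⟩ <;> decide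

/-- `R² + R + 1 = 0` (the 3-cycle acts on `P` with characteristic polynomial `x² + x + 1`; `P ⊗ ℚ` is the
irreducible `2`-dimensional representation `ρ` of `S₃`). [folklore] -/
theorem R_sq_add_R_add_one :
    (!![0, -1; 1, -1] : Matrix (Fin 2) (Fin 2) ℤ) * !![0, -1; 1, -1] + !![0, -1; 1, -1] + 1 = 0 := by
  decide

/-- `X = 1 + 2R = R − R²` for `X = [[1,−2],[2,−1]]`: `X` is the matrix of the group-ring element
`r − r²` on `P`. [folklore] -/
theorem X_eq :
    (!![1, -2; 2, -1] : Matrix (Fin 2) (Fin 2) ℤ) = 1 + (2 : ℤ) • !![0, -1; 1, -1] ∧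
    (!![1, -2; 2, -1] : Matrix (Fin 2) (Fin 2) ℤ) =
      !![0, -1; 1, -1] - !![0, -1; 1, -1] * !![0, -1; 1, -1] := by
  refine ⟨?_, ?_⟩ <;> decide

/-- **`X` intertwines the representation `P` with its sign twist:** `X R = R X` and `X S = −S X`.
READING: `P ≅ sgn ⊗ P` over every ring in which `det X = 3` is a unit (`ℤ₂`, `ℤ_p` for `p ≥ 5`, `ℚ`),
NOT over `ℤ₃` or `ℤ`; globally, `X` is the matrix of the isogeny `r − r² : B → B^{(D)}` of degree `9`
(memo §1). [folklore] -/
theorem X_intertwines :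
    (!![1, -2; 2, -1] : Matrix (Fin 2) (Fin 2) ℤ) * !![0, -1; 1, -1] = !![0, -1; 1, -1] * !![1, -2; 2, -1] ∧
    (!![1, -2; 2, -1] : Matrix (Fin 2) (Fin 2) ℤ) * !![-1, 1; 0, 1] =
      -(!![-1, 1; 0, 1] * !![1, -2; 2, -1]) := by
  refine ⟨?_, ?_⟩ <;> decide

/-- `det X = 3`. [folklore] -/
theorem det_X : (!![1, -2; 2, -1] : Matrix (Fin 2) (Fin 2) ℤ).det = 3 := by
  simp [Matrix.det_fin_two]

/-- The adjugate identity `X · [[−1,2],[−2,1]] = 3`: `X` is invertible exactly after inverting `3`.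
[folklore] -/
theorem X_mul_adj :
    (!![1, -2; 2, -1] : Matrix (Fin 2) (Fin 2) ℤ) * !![-1, 2; -2, 1] =
      (3 : ℤ) • (1 : Matrix (Fin 2) (Fin 2) ℤ) := by
  decide

/-- Conversely EVERY intertwiner is a multiple of `X`: if `Y R = R Y` and `Y S + S Y = 0`, then
`Y = (Y 0 0) • X`; in particular no intertwiner is invertible over `ℤ` or `ℤ₃` (`det (a • X) = 3a²`):
`Hom_{S₃}(P, sgn ⊗ P) = ℤ · X`. [folklore] -/
theorem intertwiner_eq_smul_X (Y : Matrix (Fin 2) (Fin 2) ℤ)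
    (hr : Y * !![0, -1; 1, -1] = !![0, -1; 1, -1] * Y)
    (hs : Y * !![-1, 1; 0, 1] + !![-1, 1; 0, 1] * Y = 0) :
    Y = Y 0 0 • (!![1, -2; 2, -1] : Matrix (Fin 2) (Fin 2) ℤ) := by
  obtain ⟨a, b, c, d, hY⟩ : ∃ a b c d : ℤ, Y = !![a, b; c, d] :=
    ⟨Y 0 0, Y 0 1, Y 1 0, Y 1 1, Matrix.eta_fin_two Y⟩
  rw [hY] at hr hs
  have e00 := congrArg (fun M : Matrix (Fin 2) (Fin 2) ℤ => M 0 0) hr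
  have e01 := congrArg (fun M : Matrix (Fin 2) (Fin 2) ℤ => M 0 1) hr
  have e11 := congrArg (fun M : Matrix (Fin 2) (Fin 2) ℤ => M 1 1) hr
  have f00 := congrArg (fun M : Matrix (Fin 2) (Fin 2) ℤ => M 0 0) hs
  simp at e00 e01 e11 f00
  rw [hY]
  ext i j
  fin_cases i <;> fin_cases j <;> simp <;> omega

end S3Lattice

/-! ## (T1) The Hecke algebra of `S₃/C₂`: `J² = J + 2`, so `Res_{F/ℚ} E_F ~ E × B` by a `3`-isogeny

`J` is the adjacency matrix of the triangle (`0` on the diagonal, `1` off it) = the Hecke operator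
`T = [HrH]` on `ℤ[S₃/C₂] ≅ ℤ³`, i.e. the endomorphism `(x₀,x₁,x₂) ↦ (x₁+x₂, x₀+x₂, x₀+x₁)` of
`A = Res_{F/ℚ}E_F` (`A(ℚ̄) = E³`). -/

section Hecke

/-- Hecke relation `J² = J + 2` (the double coset `HrH` consists of two cosets): eigenvalue `2` on the
diagonal `δ(E) ⊂ A` and `−1` on the trace-zero abelian surface `B = ker(A → E)`. [folklore] -/
theorem J_sq :
    (Matrix.of (fun i j : Fin 3 => if i = j then (0 : ℤ) else 1)) *
        Matrix.of (fun i j : Fin 3 => if i = j then (0 : ℤ) else 1) =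
      Matrix.of (fun i j : Fin 3 => if i = j then (0 : ℤ) else 1) + (2 : ℤ) • 1 := by
  decide

/-- `(1 + J)(J − 2) = 0`: `1 + J = δ ∘ Tr` kills `B` and maps onto `δ(E) ≅ E`; `J − 2` kills `δ(E)` and
maps onto `B` (it is `−3` on `B`). [folklore] -/
theorem one_add_J_mul_J_sub_two :
    (1 + Matrix.of (fun i j : Fin 3 => if i = j then (0 : ℤ) else 1)) *
        (Matrix.of (fun i j : Fin 3 => if i = j then (0 : ℤ) else 1) - (2 : ℤ) • 1) = 0 := by
  decide

/-- `(1 + J) − (J − 2) = 3`: the isogeny `A → (1+J)A × (J−2)A = E × B` has kernel inside `A[3]`, so for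
every prime `p ≠ 3` the `p`-primary Selmer group, `Ш[p^∞]` (modulo divisible parts) and Mordell–Weil
`⊗ ℤ_p` of `A = Res_{F/ℚ}E_F` — i.e. of `E` over `F` (Milne 1972 §1) — are those of `E/ℚ` PLUS those of
`B/ℚ`. [folklore] -/
theorem one_add_J_sub :
    (1 + Matrix.of (fun i j : Fin 3 => if i = j then (0 : ℤ) else 1)) -
        (Matrix.of (fun i j : Fin 3 => if i = j then (0 : ℤ) else 1) - (2 : ℤ) • 1) =
      (3 : ℤ) • (1 : Matrix (Fin 3) (Fin 3) ℤ) := by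
  decide

end Hecke

/-! ## (T2) A Brauer relation with a base-field term meets the conjugacy class of any given element -/

section ArtinObstruction

variable {G : Type*} [Group G]

/-- If no conjugate `g⁻¹ t g` of `t` lies in `H`, then `t` has no fixed point on `G ⧸ H`
(`t · gH = gH ⟺ g⁻¹ t g ∈ H`). [folklore] -/
theorem fixedBy_quotient_eq_empty (H : Subgroup G) (t : G) (h : ∀ g : G, g⁻¹ * t * g ∉ H) :
    MulAction.fixedBy (G ⧸ H) t = ∅ := by
  ext x
  simp only [MulAction.mem_fixedBy, Set.mem_empty_iff_false, iff_false]
  induction x using QuotientGroup.induction_on with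
  | H g =>
    intro hfix
    rw [MulAction.Quotient.smul_mk, QuotientGroup.eq] at hfix
    -- hfix : (t * g)⁻¹ * g ∈ H, i.e. g⁻¹ * t⁻¹ * g ∈ H; its inverse is g⁻¹ * t * g
    have hmem : (g⁻¹ * t⁻¹ * g)⁻¹ ∈ H := by
      rw [Subgroup.inv_mem_iff]
      simpa [mul_assoc] using hfix
    have : g⁻¹ * t * g ∈ H := by simpa [mul_assoc] using hmem
    exact h g this

/-- Conversely a conjugate of `t` inside `H` gives a fixed point: `g⁻¹ t g ∈ H ⟹ t · gH = gH`.
[folklore] -/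
theorem mk_mem_fixedBy_of_conj_mem (H : Subgroup G) (t g : G) (h : g⁻¹ * t * g ∈ H) :
    (QuotientGroup.mk g : G ⧸ H) ∈ MulAction.fixedBy (G ⧸ H) t := by
  rw [MulAction.mem_fixedBy, MulAction.Quotient.smul_mk, QuotientGroup.eq]
  have : (g⁻¹ * t * g)⁻¹ ∈ H := H.inv_mem h
  simpa [mul_assoc] using this

/-- On `G ⧸ ⊤` (one point) every element has exactly one fixed point: the permutation character of
the base field term is `1` at every `t`. [folklore] -/
theorem natCard_fixedBy_quotient_top (t : G) :
    Nat.card (MulAction.fixedBy (G ⧸ (⊤ : Subgroup G)) t) = 1 := by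
  haveI : Subsingleton (G ⧸ (⊤ : Subgroup G)) := QuotientGroup.subsingleton_quotient_top
  have hmem : (QuotientGroup.mk 1 : G ⧸ (⊤ : Subgroup G)) ∈
      MulAction.fixedBy (G ⧸ (⊤ : Subgroup G)) t := by
    rw [MulAction.mem_fixedBy]; exact Subsingleton.elim _ _
  exact Nat.card_of_subsingleton (⟨_, hmem⟩ : MulAction.fixedBy (G ⧸ (⊤ : Subgroup G)) t)

/-- **(T2, core) A virtual permutation character supported — apart from the base-field term `⊤` — on
subgroups missing the conjugacy class of `t` evaluates to `n ⊤` at `t`.** Hence a Brauer relation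
`Σ_H n_H · Ind_H^G 𝟙 = 0` (evaluated at `t`: `Σ n_H · #Fix_t(G ⧸ H) = 0`) with `n_⊤ ≠ 0` must involve some
`H ≠ ⊤`, `n_H ≠ 0`, containing a conjugate of `t`. READING (memo §2): for `t` an inertia element at `2`
acting non-scalarly on `V_ℓ(E)` such an `H` is a field `M^H` over which `E` is ADDITIVE at a prime above
`2`; Artin-formalism descent of BSD quotients to `ℚ` always keeps an additive-at-`2` term. [folklore] -/
theorem sum_permChar_eq_coeff_top (S : Finset (Subgroup G)) (n : Subgroup G → ℤ) (t : G)
    (htop : (⊤ : Subgroup G) ∈ S)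
    (hgood : ∀ H ∈ S, H ≠ ⊤ → n H ≠ 0 → ∀ g : G, g⁻¹ * t * g ∉ H) :
    ∑ H ∈ S, n H * (Nat.card (MulAction.fixedBy (G ⧸ H) t) : ℤ) = n ⊤ := by
  classical
  rw [← Finset.add_sum_erase S _ htop, natCard_fixedBy_quotient_top, Nat.cast_one, mul_one]
  suffices hz : ∑ H ∈ S.erase ⊤, n H * (Nat.card (MulAction.fixedBy (G ⧸ H) t) : ℤ) = 0 by
    rw [hz, add_zero]
  refine Finset.sum_eq_zero fun H hH => ?_
  obtain ⟨hne, hS⟩ := Finset.mem_erase.mp hH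
  by_cases hn : n H = 0
  · rw [hn, zero_mul]
  · have hempty := fixedBy_quotient_eq_empty H t (hgood H hS hne hn)
    rw [hempty]
    simp

/-- **(T2, relation form).** If `Σ_{H ∈ S} n_H · #Fix_t(G ⧸ H) = 0` (a Brauer relation evaluated at `t`)
and `n_⊤ ≠ 0`, then some `H ∈ S`, `H ≠ ⊤`, with `n_H ≠ 0` contains a conjugate of `t`. [folklore] -/
theorem exists_conj_mem_of_relation (S : Finset (Subgroup G)) (n : Subgroup G → ℤ) (t : G)
    (htop : (⊤ : Subgroup G) ∈ S)
    (hrel : ∑ H ∈ S, n H * (Nat.card (MulAction.fixedBy (G ⧸ H) t) : ℤ) = 0) (hn : n ⊤ ≠ 0) :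
    ∃ H ∈ S, H ≠ ⊤ ∧ n H ≠ 0 ∧ ∃ g : G, g⁻¹ * t * g ∈ H := by
  by_contra hcon
  have hgood : ∀ H ∈ S, H ≠ ⊤ → n H ≠ 0 → ∀ g : G, g⁻¹ * t * g ∉ H :=
    fun H hS hne hnH g hg => hcon ⟨H, hS, hne, hnH, g, hg⟩
  have key := sum_permChar_eq_coeff_top S n t htop hgood
  exact hn (by rw [← key, hrel])

end ArtinObstruction

end Summit.BirchSwinnertonDyer.BirchSwinnertonDyer.Theorems.CubicResolvent.RoadClosed
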